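import Summits.HodgeConjecture.CorCM.Census.DecicWeil23PairExtraction
import Summits.HodgeConjecture.CorCM.OcticCurveFourfoldFrameTransfer
import Summits.HodgeConjecture.CorCM.QuadraticCMTypeSlice
import Summits.HodgeConjecture.CorCM.CMWeightDistribution
import HarnessLib

/-!
# COR-CM — two `(2,3)`-types over one DECIC CM field `K ⊇ k`: `E × B₁ × B₂` — FRAME TRANSFER (Galois-balanced weights of
# every product of copies are model-balanced under `A₅`-realisation), the divisor lines of conjugate pairs, and the type count

Cell `pub-hodgecm2` (COR-CM), seat b30 gen 22 (2026-08-22); count-neutral own lane DECIC-WEIL-23PAIR, over the kernel census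
`Census/DecicWeil23Pair{,Parts,Extraction}`.  Theorems, plus TWO bookkeeping definitions (the slot map `pairSlots` and the model
map `toPtD`, the three-slot degree-`10` analogues of `OcticWeilOrbit.orbitSlots` / `toPt₃`); no named fact, no `sorry`.

SETTING.  A family of CM fields `Kf : I → Type`, indices `i₀` (the quadratic field `k = Kf i₀`, `τ : k → ℂ`) and `i₁` (the decic
field `K = Kf i₁`, `i : k → K`); three slots `pairSlots i₀ i₁ = (i₀, i₁, i₁)` (`Fin.cons`, so that slot `m+1` is DEFINITIONALLY
`i₁`); realisations `A₃ j ⊨ (Kf (pairSlots j); Φ₃ j)`: `E = A₃ 0 ⊨ (k; {τ})` (`hΨ`) and `B_{m+1} = A₃ (m+1) ⊨ (K; Φ_m)` with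
`s ∈ Φ_m ⟺ (e s).2 = inPos c m (e s).1` (`hΦ`) in a FRAME `e : Hom(K, ℂ) ≃ Fin 5 × Bool` (`he_sign`: `(e s).2 = [s ∘ i = τ]`;
`he_conj`: `e s̄ = ((e s).1, ¬(e s).2)`).  A product of copies is `X = ⨁_j A₃(κ j)`, `κ : Fin N → Fin 3` arbitrary; its
index set `Σ_j Hom(K_{κ j}, ℂ)` projects to that of `Y = ⨁ A₃` by `P = Sigma.map κ id` and to the 22-point model by
`v = toPtD e τ ∘ P`.  THE GALOIS INPUT `hgal`: each of the sixty even permutations `permD r` of the pairs is realised by an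
automorphism `ρ` of `ℂ` (`ρ ∘ e⁻¹(a, true) = e⁻¹(permD r a, true)`; from `3`-transitivity by `DecicWeil23Pair.hgal_of_h3t`).

* §1 the model map (cases, injectivity, conjugation `toPtD x̄ = cjD (toPtD x)`), how a realiser of `permD r` acts (it fixes `τ`,
  keeps signs and moves the pair `a` to `permD r a`: `apply_comp_eq_of_realisesD`), membership `ρ ∘ x ∈ Φ₃ ⟺ toPtD x ∈ phiD c r`;
* §2 **`modelBalancedD_of_isGaloisBalancedAlg`** — FRAME TRANSFER for every slot map `κ`;
* §3 `weightClassesAlg_le_algebraicClasses_of_isPairPartD` (pair parts have divisor lines); §4 `typeCount_eq_three_of_frameD`.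
HONEST FRAMING: nothing about the Hodge conjecture is concluded here; `HC_CM` is not asserted.
[cite: Pohlmann1968, Thm 1] [cite: GaoUllmo2025, Thm 3.1 (3.2)] [cite: Shimura1998, §18.2 Lemma (i)]
[cite: Gordon1999HodgeAVSurvey, 9.2.2] [cite: Milne2020HodgeClassesAV, 1.2 (a) and Thm. 1] [cite: Deligne1982HodgeCycles, §4 Prop. 4.4]

## References
* [Pohlmann1968] Ann. of Math. 88 (1968), Thm 1.  [GaoUllmo2025] J. Inst. Math. Jussieu 25 (2025), Thm 3.1 (3.2).  [Shimura1998]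
  G. Shimura, *Abelian varieties with CM and modular functions*, §18.2 Lemma (i).  [Gordon1999HodgeAVSurvey] CRM Monogr. 10
  (1999), 9.2.2.  [Milne2020HodgeClassesAV] arXiv:2010.08857, 1.2 (a), Thm. 1.  [Deligne1982HodgeCycles] LNM 900, §4 Prop. 4.4.
-/

noncomputable section

open CategoryTheory CategoryTheory.Limits NumberField

namespace Summit.HodgeConjecture.CorCM.DecicWeil23Pair

open Literature.AlgebraicGeometry Literature.AlgebraicGeometry.Motives Literature.AlgebraicGeometry.HodgeTheory
open Literature.AlgebraicGeometry.ComplexMultiplication (IsCMTypeRealisation)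
open Literature.AlgebraicGeometry.Pohlmann1968
open Literature.AlgebraicTopology.SingularHomology
open Literature.NumberTheory.ComplexMultiplication
open Summit.HodgeConjecture.CorCM.Census.DecicWeil23Pair (PtD cjD cjD_inl cjD_inr cjD_facts permD permD_facts inPos signTabD
  signTabD_zero card_inPos phiD inl_mem_phiD inr_mem_phiD ModelBalancedD IsPairPartD)
open Summit.HodgeConjecture.CorCM.OcticCurveFourfold (comp_injective comp_conjugate)
open Summit.HodgeConjecture.CorCM.CMWeights (weightClassesAlg_comp_le_algebraicClasses_of_injOn)
open Summit.HodgeConjecture.CorCM.PairWeights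
open Summit.HodgeConjecture.CorCM.DihedralSexticPairCurvePowers (ncard_sep_eq_card_filter)
open Summit.HodgeConjecture.CorCM.DihedralSexticPair (card_filter_equiv_mem)

open scoped Classical Pointwise

/-! ## §0 The slot map and the model map -/

section Defs

variable {I : Type}

/-- The fields of the three slots of `E × B₁ × B₂`: `(i₀, i₁, i₁)` — `Fin.cons`, so that `pairSlots i₀ i₁ (m+1)` is
DEFINITIONALLY `i₁` for every `m : Fin 2`. [folklore] -/
def pairSlots (i₀ i₁ : I) : Fin 3 → I := Fin.cons i₀ fun _ : Fin 2 => i₁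

variable {Kf : I → Type} [∀ i, Field (Kf i)] {i₀ i₁ : I}

/-- **The model map** `Hom(k × K × K, ℂ) → PtD`: `(0, σ) ↦ inl [σ = τ]`, `(m+1, s) ↦ inr (m, e s)`. [folklore] -/
def toPtD (e : (Kf i₁ →+* ℂ) ≃ Fin 5 × Bool) (τ : Kf i₀ →+* ℂ) :
    ((j : Fin 3) × (Kf (pairSlots i₀ i₁ j) →+* ℂ)) → PtD := fun x =>
  Fin.cases (motive := fun j => (Kf (pairSlots i₀ i₁ j) →+* ℂ) → PtD)
    (fun σ => Sum.inl (decide (σ = τ))) (fun m s => Sum.inr (m, e s)) x.1 x.2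

/-- `toPtD` on the curve slot. [folklore] -/
@[simp] theorem toPtD_zero (e : (Kf i₁ →+* ℂ) ≃ Fin 5 × Bool) (τ : Kf i₀ →+* ℂ) (σ : Kf i₀ →+* ℂ) :
    toPtD e τ ⟨0, σ⟩ = Sum.inl (decide (σ = τ)) := rfl

/-- `toPtD` on the fivefold slots. [folklore] -/
@[simp] theorem toPtD_succ (e : (Kf i₁ →+* ℂ) ≃ Fin 5 × Bool) (τ : Kf i₀ →+* ℂ) (m : Fin 2) (s : Kf i₁ →+* ℂ) :
    toPtD e τ ⟨m.succ, s⟩ = Sum.inr (m, e s) := rfl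

end Defs

/-! ## §1 The model map: cases, injectivity, conjugation; how a realiser of `permD r` acts -/

section Transfer

variable {I : Type} {Kf : I → Type} [∀ i, Field (Kf i)]
  {i₀ i₁ : I} {e : (Kf i₁ →+* ℂ) ≃ Fin 5 × Bool} {τ : Kf i₀ →+* ℂ}
  (hττ : ComplexEmbedding.conjugate τ ≠ τ) (hk : ∀ σ : Kf i₀ →+* ℂ, σ = τ ∨ σ = ComplexEmbedding.conjugate τ)

/-- Every point of the index set is `(0, σ)` or `(m+1, s)`. [folklore] -/
theorem sigma_casesD (x : (j : Fin 3) × (Kf (pairSlots i₀ i₁ j) →+* ℂ)) :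
    (∃ σ : Kf i₀ →+* ℂ, x = ⟨0, σ⟩) ∨ ∃ (m : Fin 2) (s : Kf i₁ →+* ℂ), x = ⟨m.succ, s⟩ := by
  obtain ⟨j, s⟩ := x
  refine Fin.cases ?_ (fun m => ?_) j s
  · exact fun σ => Or.inl ⟨σ, rfl⟩
  · exact fun s => Or.inr ⟨m, s, rfl⟩

include hττ hk in
/-- The model map is injective (`Hom(k, ℂ) = {τ, τ̄}`, `e` a bijection, the slot is recorded). [folklore] -/
theorem toPtD_injective : Function.Injective (toPtD (i₀ := i₀) (i₁ := i₁) e τ) := by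
  intro x y hxy
  rcases sigma_casesD x with ⟨σ, rfl⟩ | ⟨m, s, rfl⟩ <;> rcases sigma_casesD y with ⟨σ', rfl⟩ | ⟨m', s', rfl⟩
  · rw [toPtD_zero, toPtD_zero, Sum.inl.injEq] at hxy
    rcases hk σ with rfl | rfl <;> rcases hk σ' with rfl | rfl
    · rfl
    · simp only [decide_true] at hxy; exact absurd (of_decide_eq_true hxy.symm) hττ
    · simp only [decide_true] at hxy; exact absurd (of_decide_eq_true hxy) hττ
    · rfl
  · exact absurd hxy (by rw [toPtD_zero, toPtD_succ]; exact Sum.inl_ne_inr)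
  · exact absurd hxy (by rw [toPtD_zero, toPtD_succ]; exact Sum.inr_ne_inl)
  · rw [toPtD_succ, toPtD_succ, Sum.inr.injEq, Prod.mk.injEq] at hxy
    obtain ⟨rfl, h2⟩ := hxy
    rw [e.injective h2]

/-- Complex conjugation on the curve slot of the index set. [folklore] -/
theorem conj_smul_zeroD (σ : Kf i₀ →+* ℂ) :
    (starRingAut : ℂ ≃+* ℂ) • (⟨0, σ⟩ : (j : Fin 3) × (Kf (pairSlots i₀ i₁ j) →+* ℂ)) =
      ⟨0, (ComplexEmbedding.conjugate σ : Kf i₀ →+* ℂ)⟩ :=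
  Sigma.ext rfl (heq_of_eq (RingHom.ext fun _ => rfl))

/-- Complex conjugation on the fivefold slots of the index set. [folklore] -/
theorem conj_smul_succD (m : Fin 2) (s : Kf i₁ →+* ℂ) :
    (starRingAut : ℂ ≃+* ℂ) • (⟨m.succ, s⟩ : (j : Fin 3) × (Kf (pairSlots i₀ i₁ j) →+* ℂ)) =
      ⟨m.succ, (ComplexEmbedding.conjugate s : Kf i₁ →+* ℂ)⟩ :=
  Sigma.ext rfl (heq_of_eq (RingHom.ext fun _ => rfl))

variable {i : Kf i₀ →+* Kf i₁}
  (he_sign : ∀ s : Kf i₁ →+* ℂ, (e s).2 = true ↔ s.comp i = τ)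
  (he_conj : ∀ s : Kf i₁ →+* ℂ, e (ComplexEmbedding.conjugate s) = ((e s).1, !(e s).2))

include he_conj hττ hk in
/-- Conjugation is read in the model: `toPtD x̄ = cjD (toPtD x)`. [folklore] -/
theorem toPtD_conj_smul (x : (j : Fin 3) × (Kf (pairSlots i₀ i₁ j) →+* ℂ)) :
    toPtD e τ ((starRingAut : ℂ ≃+* ℂ) • x) = cjD (toPtD e τ x) := by
  rcases sigma_casesD x with ⟨σ, rfl⟩ | ⟨m, s, rfl⟩
  · have key : decide (ComplexEmbedding.conjugate σ = τ) = !decide (σ = τ) := by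
      rcases hk σ with rfl | rfl
      · rw [decide_eq_false hττ]; simp
      · rw [ComplexEmbedding.involutive_conjugate, decide_eq_false hττ]; simp
    rw [conj_smul_zeroD, toPtD_zero, toPtD_zero, key, cjD_inl]
  · rw [conj_smul_succD, toPtD_succ, toPtD_succ, he_conj, cjD_inr]

/-! ### How a realiser of the even permutation `permD r` acts -/

include he_conj in
/-- **A realiser of `permD r` acts on the frame by `e (ρ ∘ s) = (permD r (e s).1, (e s).2)`**: it maps the pair `a` to the
pair `permD r a` keeping the member over `τ`, and commutes with complex conjugation (`comp_conjugate`), so it keeps the other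
member too. [cite: Shimura1998, §18.2 Lemma (i)] -/
theorem apply_comp_eq_of_realisesD [NumberField (Kf i₁)] [IsCMField (Kf i₁)] (ρ : ℂ ≃+* ℂ) {r : Fin 60}
    (hρ : ∀ a : Fin 5, (ρ : ℂ →+* ℂ).comp (e.symm (a, true)) = e.symm (permD r a, true)) (s : Kf i₁ →+* ℂ) :
    e ((ρ : ℂ →+* ℂ).comp s) = (permD r (e s).1, (e s).2) := by
  cases h2 : (e s).2
  · -- `s` is the conjugate of the member `e⁻¹((e s).1, true)` of its pair
    have hs : s = ComplexEmbedding.conjugate (e.symm ((e s).1, true)) := by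
      apply e.injective
      rw [he_conj, Equiv.apply_symm_apply]
      exact Prod.ext rfl (by rw [h2]; rfl)
    rw [hs, comp_conjugate ρ, he_conj, hρ, Equiv.apply_symm_apply, ← hs]
    rfl
  · have hs : s = e.symm ((e s).1, true) := by
      apply e.injective
      rw [Equiv.apply_symm_apply]
      exact Prod.ext rfl h2
    rw [hs, hρ, Equiv.apply_symm_apply, ← hs]

include he_sign in
/-- **A realiser of `permD r` fixes `τ`** (`e⁻¹(0, true)` and its image both lie over `τ`). [cite: Shimura1998, §18.2 Lemma (i)] -/
theorem comp_tau_eq_of_realisesD (ρ : ℂ ≃+* ℂ) {r : Fin 60}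
    (hρ : ∀ a : Fin 5, (ρ : ℂ →+* ℂ).comp (e.symm (a, true)) = e.symm (permD r a, true)) :
    (ρ : ℂ →+* ℂ).comp τ = τ := by
  have h0 : (e.symm ((0 : Fin 5), true)).comp i = τ := (he_sign _).1 (by rw [Equiv.apply_symm_apply])
  have h1 : (e.symm (permD r 0, true)).comp i = τ := (he_sign _).1 (by rw [Equiv.apply_symm_apply])
  calc (ρ : ℂ →+* ℂ).comp τ = ((ρ : ℂ →+* ℂ).comp (e.symm (0, true))).comp i := by rw [RingHom.comp_assoc, h0]
    _ = τ := by rw [hρ, h1]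

include hττ hk he_sign in
/-- Hence on `Hom(k, ℂ) = {τ, τ̄}`: `ρ ∘ σ = τ ⟺ σ = τ`. [folklore] -/
theorem comp_eq_tau_iff_of_realisesD (ρ : ℂ ≃+* ℂ) {r : Fin 60}
    (hρ : ∀ a : Fin 5, (ρ : ℂ →+* ℂ).comp (e.symm (a, true)) = e.symm (permD r a, true)) (σ : Kf i₀ →+* ℂ) :
    (ρ : ℂ →+* ℂ).comp σ = τ ↔ σ = τ := by
  have hρτ := comp_tau_eq_of_realisesD he_sign ρ hρ
  rcases hk σ with rfl | rfl
  · exact ⟨fun _ => rfl, fun _ => hρτ⟩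
  · constructor
    · intro h
      exact absurd (comp_injective (K := Kf i₀) ρ (h.trans hρτ.symm)) hττ
    · intro h
      exact absurd h hττ

variable {c : Bool} {Φ₃ : ∀ j : Fin 3, CMType (Kf (pairSlots i₀ i₁ j))}
  (hΦ : ∀ (m : Fin 2) (s : Kf i₁ →+* ℂ), s ∈ (Φ₃ m.succ).1 ↔ (e s).2 = inPos c m (e s).1)
  (hΨ : ∀ σ : Kf i₀ →+* ℂ, σ ∈ (Φ₃ 0).1 ↔ σ = τ)

include he_conj hΦ in
/-- **How a realiser of `permD r` acts on a fivefold slot of type `m`**: `ρ ∘ s ∈ Φ_m ⟺ inr (m, e s) ∈ phiD c r`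
(`ρ` keeps signs and moves the pair `a` to `permD r a`; `signTabD c r m a = [permD r a ∈ I_m]`). [cite: GaoUllmo2025, Thm 3.1 (3.2)] -/
theorem comp_mem_iff_of_realisesD [NumberField (Kf i₁)] [IsCMField (Kf i₁)] (ρ : ℂ ≃+* ℂ) {r : Fin 60}
    (hρ : ∀ a : Fin 5, (ρ : ℂ →+* ℂ).comp (e.symm (a, true)) = e.symm (permD r a, true)) (m : Fin 2)
    (s : Kf i₁ →+* ℂ) : (ρ : ℂ →+* ℂ).comp s ∈ (Φ₃ m.succ).1 ↔ (Sum.inr (m, e s) : PtD) ∈ phiD c r := by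
  rw [hΦ, apply_comp_eq_of_realisesD he_conj ρ hρ s, inr_mem_phiD]
  exact Iff.rfl

include hττ hk he_sign he_conj hΦ hΨ in
/-- **Membership read in the frame**: for a realiser `ρ` of `permD r`, `ρ ∘ x ∈ Φ₃ ↔ toPtD x ∈ phiD c r` (on the curve slot
`ρ` fixes `τ`, and `inl b ∈ phiD c r ↔ b = true`). [cite: GaoUllmo2025, Thm 3.1 (3.2)] -/
theorem comp_mem_iff_toPtD_mem [NumberField (Kf i₁)] [IsCMField (Kf i₁)] {ρ : ℂ ≃+* ℂ} {r : Fin 60}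
    (hρ : ∀ a : Fin 5, (ρ : ℂ →+* ℂ).comp (e.symm (a, true)) = e.symm (permD r a, true))
    (x : (j : Fin 3) × (Kf (pairSlots i₀ i₁ j) →+* ℂ)) :
    (ρ : ℂ →+* ℂ).comp x.2 ∈ (Φ₃ x.1).1 ↔ toPtD e τ x ∈ phiD c r := by
  rcases sigma_casesD x with ⟨σ, rfl⟩ | ⟨m, s, rfl⟩
  · change (ρ : ℂ →+* ℂ).comp σ ∈ (Φ₃ 0).1 ↔ _
    rw [hΨ, toPtD_zero, inl_mem_phiD, comp_eq_tau_iff_of_realisesD hττ hk he_sign ρ hρ σ]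
    exact ⟨fun h => decide_eq_true h, fun h => of_decide_eq_true h⟩
  · exact comp_mem_iff_of_realisesD he_conj hΦ ρ hρ m s

/-! ## §2 Frame transfer for the products of copies -/

variable {N : ℕ} (κ : Fin N → Fin 3)

include hττ hk he_sign he_conj hΦ hΨ in
/-- **FRAME TRANSFER** (`A₅`-realisation): an `Aut(ℂ)`-balanced weight of `X = ⨁_j A₃(κ j)` (`IsGaloisBalancedAlg` for the CM
algebra `∏_j K_{κ j}`, types `Φ₃ (κ j)`) is a balanced configuration of the model of `Census/DecicWeil23Pair` under
`v = toPtD e τ ∘ P`, `P (j, s) = (κ j, s)`: each even permutation `permD r` of the conjugate pairs is realised by an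
automorphism of `ℂ` (`hgal`), whose balance condition is the model's `r`-th equation.
[cite: GaoUllmo2025, Thm 3.1 (3.2)] [cite: Pohlmann1968, Thm 1] -/
theorem modelBalancedD_of_isGaloisBalancedAlg [NumberField (Kf i₁)] [IsCMField (Kf i₁)]
    (hgal : ∀ r : Fin 60, ∃ ρ : ℂ ≃+* ℂ,
      ∀ a : Fin 5, (ρ : ℂ →+* ℂ).comp (e.symm (a, true)) = e.symm (permD r a, true))
    {S : Finset ((j : Fin N) × (Kf (pairSlots i₀ i₁ (κ j)) →+* ℂ))}
    (hS : IsGaloisBalancedAlg (K := fun j => Kf (pairSlots i₀ i₁ (κ j))) (fun j => Φ₃ (κ j)) S) :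
    ModelBalancedD c (fun x => toPtD e τ ((Sigma.map κ (fun _ => id) :
      ((j : Fin N) × (Kf (pairSlots i₀ i₁ (κ j)) →+* ℂ)) → ((m : Fin 3) × (Kf (pairSlots i₀ i₁ m) →+* ℂ))) x)) S := by
  intro r
  beta_reduce
  obtain ⟨ρ, hρ⟩ := hgal r
  have h := hS ρ
  rw [ncard_sep_eq_card_filter, ncard_sep_eq_card_filter] at h
  have key : ∀ x : (j : Fin N) × (Kf (pairSlots i₀ i₁ (κ j)) →+* ℂ),
      (ρ : ℂ →+* ℂ).comp x.2 ∈ (Φ₃ (κ x.1)).1 ↔ toPtD e τ ((Sigma.map κ (fun _ => id) :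
        ((j : Fin N) × (Kf (pairSlots i₀ i₁ (κ j)) →+* ℂ)) → ((m : Fin 3) × (Kf (pairSlots i₀ i₁ m) →+* ℂ))) x)
          ∈ phiD c r :=
    fun x => comp_mem_iff_toPtD_mem hττ hk he_sign he_conj hΦ hΨ hρ ⟨κ x.1, x.2⟩
  rw [Finset.filter_congr fun x _ => key x, Finset.filter_congr fun x _ => (key x).not] at h
  have htot := Finset.card_filter_add_card_filter_not
    (s := S) (fun x => toPtD e τ ((Sigma.map κ (fun _ => id) :
        ((j : Fin N) × (Kf (pairSlots i₀ i₁ (κ j)) →+* ℂ)) → ((m : Fin 3) × (Kf (pairSlots i₀ i₁ m) →+* ℂ))) x)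
          ∈ phiD c r)
  omega

end Transfer

/-! ## §3 Conjugate pairs have algebraic (divisor) lines -/

section Pairs

variable {I : Type} {Kf : I → Type} [∀ i, Field (Kf i)] [∀ i, NumberField (Kf i)] [∀ i, IsCMField (Kf i)]
  {i₀ i₁ : I} {N : ℕ} (κ : Fin N → Fin 3) {e : (Kf i₁ →+* ℂ) ≃ Fin 5 × Bool} {τ : Kf i₀ →+* ℂ}
  (hττ : ComplexEmbedding.conjugate τ ≠ τ) (hk : ∀ σ : Kf i₀ →+* ℂ, σ = τ ∨ σ = ComplexEmbedding.conjugate τ)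
  (he_conj : ∀ s : Kf i₁ →+* ℂ, e (ComplexEmbedding.conjugate s) = ((e s).1, !(e s).2))
  {A₃ : Fin 3 → AbelianVariety ℂ} {Φ₃ : ∀ j : Fin 3, CMType (Kf (pairSlots i₀ i₁ j))}
  {ι₃ : ∀ j, 𝓞 (Kf (pairSlots i₀ i₁ j)) →+* End (A₃ j)}
  {θ₃ : ∀ j, Kf (pairSlots i₀ i₁ j) →+* Module.End ℂ (complexBetti (A₃ j).X 1)}
  (hA : ∀ j, IsCMTypeRealisation (Φ₃ j) (A₃ j) (ι₃ j) (θ₃ j))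

include hττ hk he_conj hA in
/-- **A weight of `Y = ⨁ A₃` whose model image is a conjugate pair `{y, cjD y}` is conjugation-stable, so its line is
algebraic** (a divisor line: Lefschetz `(1,1)` on the abelian variety `⨁ A₃`). [cite: Gordon1999HodgeAVSurvey, 9.2.2] -/
theorem weightClassesAlg_le_algebraicClasses_of_image_eq_pairD
    {T : Finset ((j : Fin 3) × (Kf (pairSlots i₀ i₁ j) →+* ℂ))} {y : PtD} (hT : T.image (toPtD e τ) = {y, cjD y}) :
    T.card = 2 ∧ weightClassesAlg A₃ ι₃ (2 * 1) T ≤ algebraicClasses (⨁ A₃).X 1 := by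
  have hinj := toPtD_injective (e := e) hττ hk (i₁ := i₁)
  have hcard : T.card = 2 := by
    rw [← Finset.card_image_of_injective T hinj, hT]
    exact Finset.card_pair (cjD_facts.2 y).symm
  refine ⟨hcard, weightClassesAlg_le_algebraicClasses_of_conj_smul_mem hA (m := 1) hcard fun x hx => ?_⟩
  have hx' : toPtD e τ x ∈ ({y, cjD y} : Finset PtD) := hT ▸ Finset.mem_image_of_mem _ hx
  have hcx : toPtD e τ ((starRingAut : ℂ ≃+* ℂ) • x) ∈ T.image (toPtD e τ) := by
    rw [toPtD_conj_smul hττ hk he_conj x, hT, Finset.mem_insert, Finset.mem_singleton] at *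
    rcases hx' with h | h
    · exact Or.inr (by rw [h])
    · exact Or.inl (by rw [h, cjD_facts.1])
  exact (hinj.mem_finset_image).1 hcx

include hττ hk he_conj hA in
/-- **A pair part of a weight of `X = ⨁_j A₃(κ j)` has an algebraic (divisor) line**: the model map is injective on it with
image a conjugate pair, so its slot projection to `Y = ⨁ A₃` is a weight with the same image — a divisor line — and seat b30's
distribution lemma lifts it along `κ`. [cite: Gordon1999HodgeAVSurvey, 9.2.2] [cite: Milne2020HodgeClassesAV, 1.2 (a) and Thm. 1] -/
theorem weightClassesAlg_le_algebraicClasses_of_isPairPartD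
    {G : Finset ((j : Fin N) × (Kf (pairSlots i₀ i₁ (κ j)) →+* ℂ))}
    (hG : IsPairPartD (fun x => toPtD e τ ((Sigma.map κ (fun _ => id) :
      ((j : Fin N) × (Kf (pairSlots i₀ i₁ (κ j)) →+* ℂ)) → ((m : Fin 3) × (Kf (pairSlots i₀ i₁ m) →+* ℂ))) x)) G) :
    G.card = 2 * 1 ∧ weightClassesAlg (fun j => A₃ (κ j)) (fun j => ι₃ (κ j)) (2 * 1) G ≤
      algebraicClasses (⨁ fun j => A₃ (κ j)).X 1 := by
  obtain ⟨y, hcard, hinj, himg⟩ := hG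
  set P : ((j : Fin N) × (Kf (pairSlots i₀ i₁ (κ j)) →+* ℂ)) → ((m : Fin 3) × (Kf (pairSlots i₀ i₁ m) →+* ℂ)) :=
    Sigma.map κ (fun _ => id) with hP
  have hPinj : Set.InjOn P ↑G := fun x hx x' hx' h => hinj hx hx' (by change toPtD e τ (P x) = toPtD e τ (P x'); rw [h])
  set TY : Finset ((m : Fin 3) × (Kf (pairSlots i₀ i₁ m) →+* ℂ)) := G.image P with hTY
  have hTYimg : TY.image (toPtD e τ) = {y, cjD y} := by rw [hTY, Finset.image_image]; exact himg
  obtain ⟨-, hYalg⟩ := weightClassesAlg_le_algebraicClasses_of_image_eq_pairD hττ hk he_conj hA hTYimg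
  have hq : G.card = 2 * 1 := by rw [hcard]
  exact ⟨hq, weightClassesAlg_comp_le_algebraicClasses_of_injOn (K := fun m => Kf (pairSlots i₀ i₁ m)) hA κ hq
    hPinj hYalg⟩

end Pairs

/-! ## §4 The type count `(2 + 1, 3 + 0) = (3, 3)` read off the frame -/

section Counts

variable {I : Type} {Kf : I → Type} [∀ i, Field (Kf i)] [∀ i, NumberField (Kf i)] [∀ i, IsCMField (Kf i)]
  {i₀ i₁ : I} {e : (Kf i₁ →+* ℂ) ≃ Fin 5 × Bool} {τ : Kf i₀ →+* ℂ} {i : Kf i₀ →+* Kf i₁}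

/-- In the position table, exactly three of the five pairs carry the sign `false`. [folklore] -/
theorem card_inPos_false (c : Bool) (m : Fin 2) :
    ((Finset.univ : Finset (Fin 5)).filter fun a => inPos c m a = false).card = 3 := by
  revert c m; decide

/-- **A `(2,3)`-slot has exactly TWO members over `τ` and THREE over `τ̄`**: for `s ∈ Φ ⟺ (e s).2 = inPos c m (e s).1`,
`#{s ∈ Φ | s ∘ i = τ'} = 2` or `3` according as `τ' = τ` or `τ' = τ̄`, so that with `Ψ = {τ}` the count
`#{s ∈ Φ | s ∘ i = τ'} + [τ' ∈ Ψ]` is `3` for both — the Weil-type condition `(3,3)` of seat b09's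
`DecicCurveFivefold.weilClassesOf_le_algebraicClasses_cmFivefold_prod_cmCurve_of_markmanSixfold` for the sixfold `B_m × E`.
[cite: Deligne1982HodgeCycles, §4 Prop. 4.4] -/
theorem typeCount_eq_three_of_frameD (h2 : Module.finrank ℚ (Kf i₀) = 2)
    (he_sign : ∀ s : Kf i₁ →+* ℂ, (e s).2 = true ↔ s.comp i = τ) (c : Bool) (m : Fin 2)
    {Φ : CMType (Kf i₁)} (hΦ : ∀ s : Kf i₁ →+* ℂ, s ∈ Φ.1 ↔ (e s).2 = inPos c m (e s).1)
    {Ψ : CMType (Kf i₀)} (hΨ : ∀ σ : Kf i₀ →+* ℂ, σ ∈ Ψ.1 ↔ σ = τ) (τ' : Kf i₀ →+* ℂ) :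
    (Finset.univ.filter fun s : Kf i₁ →+* ℂ => s.comp i = τ' ∧ s ∈ Φ.1).card + (if τ' ∈ Ψ.1 then 1 else 0) = 3 := by
  have hττ : ComplexEmbedding.conjugate τ ≠ τ := QuarticCM.conjugate_ne τ
  have hk : ∀ σ : Kf i₀ →+* ℂ, σ = τ ∨ σ = ComplexEmbedding.conjugate τ := fun σ =>
    QuarticCM.eq_or_eq_conjugate_of_quadratic h2 τ σ
  rcases hk τ' with rfl | rfl
  · -- over `τ`: the two pairs of sign `true`
    rw [if_pos ((hΨ _).2 rfl)]
    have hfilter : (Finset.univ.filter fun s : Kf i₁ →+* ℂ => s.comp i = τ' ∧ s ∈ Φ.1) =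
        Finset.univ.filter fun s => e s ∈
          ((Finset.univ : Finset (Fin 5 × Bool)).filter fun p => p.2 = true ∧ inPos c m p.1 = true) := by
      refine Finset.filter_congr fun s _ => ?_
      rw [← he_sign, hΦ s, Finset.mem_filter]
      constructor
      · rintro ⟨h1, h2⟩; exact ⟨Finset.mem_univ _, h1, by rw [← h2, h1]⟩
      · rintro ⟨-, h1, h2⟩; exact ⟨h1, by rw [h1, h2]⟩
    have hprod : ((Finset.univ : Finset (Fin 5 × Bool)).filter fun p => p.2 = true ∧ inPos c m p.1 = true).card =
        ((Finset.univ : Finset (Fin 5)).filter fun a => inPos c m a = true).card := by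
      refine Finset.card_bij (fun p _ => p.1) (fun p hp => ?_) (fun p hp q hq h => ?_) (fun a ha => ?_)
      · exact Finset.mem_filter.2 ⟨Finset.mem_univ _, (Finset.mem_filter.1 hp).2.2⟩
      · obtain ⟨-, hp2, -⟩ := Finset.mem_filter.1 hp
        obtain ⟨-, hq2, -⟩ := Finset.mem_filter.1 hq
        exact Prod.ext h (hp2.trans hq2.symm)
      · exact ⟨(a, true), Finset.mem_filter.2 ⟨Finset.mem_univ _, rfl, (Finset.mem_filter.1 ha).2⟩, rfl⟩
    rw [hfilter, card_filter_equiv_mem, hprod, card_inPos]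
  · -- over `τ̄`: the three pairs of sign `false`
    have hnot : ComplexEmbedding.conjugate τ ∉ Ψ.1 := fun h => hττ ((hΨ _).1 h)
    rw [if_neg hnot, add_zero]
    have hsnd : ∀ s : Kf i₁ →+* ℂ, s.comp i = ComplexEmbedding.conjugate τ ↔ (e s).2 = false := by
      intro s
      constructor
      · intro h
        cases hs : (e s).2
        · rfl
        · exact absurd (((he_sign s).1 hs).symm.trans h) hττ.symm
      · exact fun h => (hk (s.comp i)).resolve_left fun h' => absurd ((he_sign s).2 h') (by rw [h]; exact Bool.false_ne_true)
    have hfilter : (Finset.univ.filter fun s : Kf i₁ →+* ℂ => s.comp i = ComplexEmbedding.conjugate τ ∧ s ∈ Φ.1) =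
        Finset.univ.filter fun s => e s ∈
          ((Finset.univ : Finset (Fin 5 × Bool)).filter fun p => p.2 = false ∧ inPos c m p.1 = false) := by
      refine Finset.filter_congr fun s _ => ?_
      rw [hsnd, hΦ s, Finset.mem_filter]
      constructor
      · rintro ⟨h1, h2⟩; exact ⟨Finset.mem_univ _, h1, by rw [← h2, h1]⟩
      · rintro ⟨-, h1, h2⟩; exact ⟨h1, by rw [h1, h2]⟩
    have hprod : ((Finset.univ : Finset (Fin 5 × Bool)).filter fun p => p.2 = false ∧ inPos c m p.1 = false).card =
        ((Finset.univ : Finset (Fin 5)).filter fun a => inPos c m a = false).card := by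
      refine Finset.card_bij (fun p _ => p.1) (fun p hp => ?_) (fun p hp q hq h => ?_) (fun a ha => ?_)
      · exact Finset.mem_filter.2 ⟨Finset.mem_univ _, (Finset.mem_filter.1 hp).2.2⟩
      · obtain ⟨-, hp2, -⟩ := Finset.mem_filter.1 hp
        obtain ⟨-, hq2, -⟩ := Finset.mem_filter.1 hq
        exact Prod.ext h (hp2.trans hq2.symm)
      · exact ⟨(a, false), Finset.mem_filter.2 ⟨Finset.mem_univ _, rfl, (Finset.mem_filter.1 ha).2⟩, rfl⟩
    rw [hfilter, card_filter_equiv_mem, hprod, card_inPos_false]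

end Counts

end Summit.HodgeConjecture.CorCM.DecicWeil23Pair

end
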